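import Mathlib
import Summits.Ventures.PercRepro2.Defs
import Summits.Ventures.PercRepro2.Harris
import Summits.Ventures.PercRepro2.FourFunctions
import Summits.Ventures.PercRepro2.Switching
import Summits.Ventures.PercRepro2.EdgeInduction

/-!
# Two-configuration Bernstein expansion and pattern positivity (blind cell PercRepro2, mine-1)

`P_p(F)P_p(G) − P_p(H)P_p(K) = ∑_{ω, ω'} w(ω) w(ω') [1_F(ω) 1_G(ω') − 1_H(ω) 1_K(ω')]`.  Grouping the
ordered pairs `(ω, ω')` by their meet `m = ω ⊓ ω'` and join `j = ω ⊔ ω'` and using the log-modularity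
`w(ω) w(ω') = w(m) w(j)` of the product weight, the slack becomes

  `∑_{(m, j)} w(m) w(j) · c(m, j)`,
  `c(m, j) = #{(ω,ω') : ω ⊓ ω' = m, ω ⊔ ω' = j, ω ∈ F, ω' ∈ G} − #{… ω ∈ H, ω' ∈ K}`,

the *pattern coefficients* of `R13-STATEMENT.md` Lemma 2.1 (`O = m`, `Y = j ∖ m`).  Since the
weights are nonnegative, `c(m, j) ≥ 0` for all patterns gives the inequality for every admissible
weight vector (Corollary 2.2).  Specialised to mine-1's row R13 at the end: R13 follows from the
nonnegativity of all its pattern coefficients, which is what the switching inequality R13-comb on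
the contractions of the graph delivers (Theorem 2.3, not formalised here).
-/

namespace Summit.Ventures.PercRepro2

section Bernstein

variable {E : Type*} [Fintype E] [DecidableEq E] {R : Type*} [CommRing R]

open Classical in
/-- The integrand of the slack at an ordered pair: `1_F(ω) 1_G(ω') − 1_H(ω) 1_K(ω')`. -/
noncomputable def pairTerm (F G H K : Set (Config E)) (ω ω' : Config E) : R :=
  (if ω ∈ F then 1 else 0) * (if ω' ∈ G then 1 else 0)
    - (if ω ∈ H then 1 else 0) * (if ω' ∈ K then 1 else 0)

open Classical in
/-- The pattern coefficient `c(mj)` at the pattern `mj = (meet, join)`: the sum of `pairTerm` over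
the ordered pairs `(ω, ω')` with `ω ⊓ ω' = mj.1` and `ω ⊔ ω' = mj.2` (the number of such pairs in
`F × G` minus the number in `H × K`). -/
noncomputable def patternCoeff (F G H K : Set (Config E)) (mj : Config E × Config E) : R :=
  ∑ x : Config E × Config E, if (x.1 ⊓ x.2, x.1 ⊔ x.2) = mj then pairTerm F G H K x.1 x.2 else 0

open Classical in
/-- `prob` as a sum of weight times a `0/1` indicator. -/
lemma prob_eq_sum_weight_mul (p : E → R) (A : Set (Config E)) :
    prob p A = ∑ ω, weight p ω * (if ω ∈ A then 1 else 0) := by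
  unfold prob
  refine Finset.sum_congr rfl fun ω _ => ?_
  by_cases h : ω ∈ A <;> simp [Set.indicator, h]

open Classical in
/-- The slack as a sum over ordered pairs of configurations. -/
lemma slack_eq_sum_pairTerm (p : E → R) (F G H K : Set (Config E)) :
    slack p F G H K =
      ∑ x : Config E × Config E, weight p x.1 * weight p x.2 * pairTerm F G H K x.1 x.2 := by
  unfold slack pairTerm
  rw [Fintype.sum_prod_type]
  simp only [prob_eq_sum_weight_mul, Finset.sum_mul_sum, ← Finset.sum_sub_distrib]
  refine Finset.sum_congr rfl fun ω _ => Finset.sum_congr rfl fun ω' _ => ?_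
  ring

open Classical in
/-- **Two-configuration Bernstein expansion**: the slack is the weighted sum of the pattern
coefficients, with weight `w(m) w(j)` on the pattern `(m, j)`. -/
theorem slack_eq_sum_patternCoeff (p : E → R) (F G H K : Set (Config E)) :
    slack p F G H K =
      ∑ mj : Config E × Config E, weight p mj.1 * weight p mj.2 * patternCoeff F G H K mj := by
  rw [slack_eq_sum_pairTerm]
  unfold patternCoeff
  simp only [Finset.mul_sum]
  rw [Finset.sum_comm]
  refine Finset.sum_congr rfl fun x _ => ?_
  have key : ∀ mj : Config E × Config E,
      weight p mj.1 * weight p mj.2 *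
        (if (x.1 ⊓ x.2, x.1 ⊔ x.2) = mj then pairTerm F G H K x.1 x.2 else 0)
      = if (x.1 ⊓ x.2, x.1 ⊔ x.2) = mj then
          weight p (x.1 ⊓ x.2) * weight p (x.1 ⊔ x.2) * pairTerm F G H K x.1 x.2 else 0 := by
    intro mj
    by_cases h : (x.1 ⊓ x.2, x.1 ⊔ x.2) = mj
    · rw [if_pos h, if_pos h, ← h]
    · rw [if_neg h, if_neg h, mul_zero]
  simp only [key]
  rw [Finset.sum_ite_eq, if_pos (Finset.mem_univ _), weight_inf_mul_weight_sup]

variable [PartialOrder R] [IsOrderedRing R]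

/-- **Pattern positivity ⇒ the inequality**: if every pattern coefficient is nonnegative then
`P_p(F)P_p(G) ≥ P_p(H)P_p(K)` for every admissible weight vector. -/
theorem slack_nonneg_of_patternCoeff_nonneg {p : E → R} (hp : IsProbVec p)
    (F G H K : Set (Config E))
    (hc : ∀ mj : Config E × Config E, (0 : R) ≤ patternCoeff F G H K mj) :
    0 ≤ slack p F G H K := by
  rw [slack_eq_sum_patternCoeff]
  refine Finset.sum_nonneg fun mj _ => ?_
  exact mul_nonneg (mul_nonneg (weight_nonneg hp mj.1) (weight_nonneg hp mj.2)) (hc mj)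

end Bernstein

section R13Bernstein

variable {V : Type*} {E : Type*} [Fintype E] [DecidableEq E] {R : Type*} [CommRing R]
  [PartialOrder R] [IsOrderedRing R]

/-- The pattern coefficients of row R13: `F = A∩C`, `G = B∩C`, `H = (A∘B)∩C`, `K = C`. -/
noncomputable def R13PatternCoeff (ends : E → Sym2 V) (s t a b : V)
    (mj : Config E × Config E) : R :=
  patternCoeff (connEvent ends s a ∩ connEvent ends s t) (connEvent ends s b ∩ connEvent ends s t)
    (disjointConnEvent ends s a b ∩ connEvent ends s t) (connEvent ends s t) mj

/-- **R13 from pattern positivity**: if all its pattern coefficients are nonnegative (Bernstein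
positivity, `R13-STATEMENT.md` §2), then `R13 p ends s t a b` for every admissible `p`. -/
theorem R13_of_patternCoeff_nonneg {p : E → R} (hp : IsProbVec p) (ends : E → Sym2 V)
    (s t a b : V)
    (hc : ∀ mj : Config E × Config E, (0 : R) ≤ R13PatternCoeff ends s t a b mj) :
    R13 p ends s t a b := by
  have h := slack_nonneg_of_patternCoeff_nonneg hp (connEvent ends s a ∩ connEvent ends s t)
    (connEvent ends s b ∩ connEvent ends s t)
    (disjointConnEvent ends s a b ∩ connEvent ends s t) (connEvent ends s t) hc
  unfold slack at h
  exact sub_nonneg.1 h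

end R13Bernstein

end Summit.Ventures.PercRepro2
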